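import Mathlib.Analysis.Complex.TaylorSeries
import Mathlib.Analysis.SpecialFunctions.Pow.Deriv
import Mathlib.Analysis.SpecialFunctions.ImproperIntegrals
import Mathlib.Analysis.SpecialFunctions.Exponential
import Mathlib.Analysis.SpecificLimits.Normed
import Mathlib.Analysis.Calculus.ParametricIntegral
import Mathlib.Analysis.Complex.Convex
import HarnessLib

/-!
# Landau's theorem for Mellin transforms of eventually non-negative functions

Topic: `Literature/NumberTheory/LFunctions`. Montgomery–Vaughan, *Multiplicative Number Theory I*,
§15.1 ("Applications of Landau's theorem"), Lemma 15.1: if `A(x)` is bounded and integrable on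
finite intervals of `[1, ∞)` and `A(x) ≥ 0` for `x > X₀`, and `σ_c` is the infimum of the `σ` with
`∫_{X₀}^∞ A(x) x^{-σ} dx < ∞`, then `F(s) = ∫_1^∞ A(x) x^{-s} dx` is analytic on `σ > σ_c` *but
not at the point `s = σ_c`*. This is the integral analogue of Landau's theorem on Dirichlet series
with non-negative coefficients (MV Thm. 1.7), and the engine of all `Ω`-theorems of MV §15.1
(Thm. 15.2: `ψ(x) − x = Ω_±(x^{Θ−ε})`, and their kin).

We formalise the lemma in the form in which it is *used* (MV, proof of Thm. 15.2: "the left-hand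
side … is analytic for real `s > Θ − ε` … Hence the above identity holds for `σ > Θ − ε`"): if the
transform agrees, on its half-plane of absolute convergence, with a function holomorphic on a
neighbourhood of a real segment `(a, σ₁]`, then the integral converges absolutely on `Re s > a`.
We write the transform as `∫_1^∞ g(x) x^{-(s+1)} dx` (`g(x) = x·A(x)`), the normalisation of
Mathlib's `LSeries_eq_mul_integral`.

## Main results (all proved, sorry-free)

* `Literature.Landau.mellinIoi g s = ∫_{(1,∞)} g(x) x^{-(s+1)} dx`, `mellinIoiLog g n s` the same with an
  extra factor `(-log x)^n` (its `n`-th `s`-derivative).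
* `hasDerivAt_mellinIoiLog`, `differentiableOn_mellinIoi`, `iteratedDeriv_mellinIoi`: holomorphy
  on the half-plane of absolute convergence and the formula for the iterated derivatives
  (differentiation under the integral sign).
* `norm_mellinIoi_le`: `‖F(s)‖ ≤ ∫ |g| x^{-(σ'+1)}` for `Re s ≥ σ'`.
* `Landau.integrableOn_of_differentiableOn_ball` — **the disc form** (MV Lemma 15.1, proof of
  Thm. 1.7 adapted): if `g ≥ 0` beyond `X₁`, the transform converges absolutely at `σ₁`, and it
  agrees near the real point `σ₂ > σ₁` with a function holomorphic on the disc `|s − σ₂| < R`, then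
  it converges absolutely at every real `σ > σ₂ − R`.
* `Landau.integrableOn_of_differentiableOn_union_convex` — **the abscissa form** (MV Lemma 15.1
  as used in Thm. 15.2): holomorphy on `{Re s > σ₁} ∪ W₀`, `W₀` a convex open set containing the
  real segment `(a, σ₁ + 1]`, forces absolute convergence on `Re s > a`.

## Proof sketch (MV, proof of Thm. 1.7 / Lemma 15.1)

The Taylor series of the continuation `Φ` at `σ₂` converges on the whole disc (Mathlib,
`Complex.hasSum_taylorSeries_on_ball`); its coefficients are the derivatives of the integral,
`∫ g (-log x)^n x^{-(σ₂+1)} dx`. At the real point `σ = σ₂ − R'` the series is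
`∑_n (R'^n/n!) ∫ g (log x)^n x^{-(σ₂+1)} dx`; the part of the integrals over `(1, X₁]` sums
absolutely, so the part over `(X₁, ∞)`, which has non-negative terms, is summable, and by monotone
convergence (Tonelli) it equals `∫_{X₁}^∞ g x^{R'} x^{-(σ₂+1)} dx = ∫_{X₁}^∞ g x^{-(σ+1)} dx < ∞`. The
abscissa form follows by applying the disc form at the infimum of the abscissae of convergence in
`[a, σ₁]`, using the identity theorem on the (preconnected) union `{Re s > σ₁} ∪ (W₀ ∩ {Re s > σ_c})`.

## References

* H. L. Montgomery, R. C. Vaughan, *Multiplicative Number Theory I. Classical Theory*, Cambridge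
  Studies in Advanced Mathematics 97, CUP 2007: §15.1, Lemma 15.1 (p. 463) and the proof of
  Thm. 15.2; §1.2, Thm. 1.7 (Landau 1905). [MontgomeryVaughan2007]
-/

noncomputable section

open Complex Filter Topology Set MeasureTheory

namespace Literature.NumberTheory.LFunctions

namespace Landau

/-! ### The transform and its formal derivatives -/

/-- The integrand `g(x) · (-log x)^n · x^{-(s+1)}` of the `n`-th derivative of the transform.
[cite: MontgomeryVaughan2007, §15.1 Lemma 15.1] -/
def mellinIntegrand (g : ℝ → ℝ) (n : ℕ) (s : ℂ) (x : ℝ) : ℂ :=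
  (g x : ℂ) * ((-(Real.log x : ℂ)) ^ n * (x : ℂ) ^ (-(s + 1)))

/-- `∫_{(1,∞)} g(x) (-log x)^n x^{-(s+1)} dx`, the `n`-th `s`-derivative of the transform
(`n = 0` is the transform itself, `mellinIoi`). [cite: MontgomeryVaughan2007, §15.1 Lemma 15.1] -/
def mellinIoiLog (g : ℝ → ℝ) (n : ℕ) (s : ℂ) : ℂ :=
  ∫ x in Ioi (1 : ℝ), mellinIntegrand g n s x

/-- The transform `F(s) = ∫_{(1,∞)} g(x) x^{-(s+1)} dx` of Landau's lemma (MV Lemma 15.1 with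
`A(x) = g(x)/x`; the normalisation of Mathlib's `LSeries_eq_mul_integral`).
[cite: MontgomeryVaughan2007, §15.1 Lemma 15.1] -/
def mellinIoi (g : ℝ → ℝ) (s : ℂ) : ℂ :=
  ∫ x in Ioi (1 : ℝ), (g x : ℂ) * (x : ℂ) ^ (-(s + 1))

/-- `mellinIoi` is the case `n = 0` of `mellinIoiLog`. [folklore] -/
theorem mellinIoiLog_zero (g : ℝ → ℝ) : mellinIoiLog g 0 = mellinIoi g := by
  funext s
  simp [mellinIoiLog, mellinIoi, mellinIntegrand]

variable {g : ℝ → ℝ}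

/-- Measurability of the integrand in `x`. [folklore] -/
theorem measurable_mellinIntegrand (hg : Measurable g) (n : ℕ) (s : ℂ) :
    Measurable (mellinIntegrand g n s) := by
  unfold mellinIntegrand
  refine (measurable_ofReal.comp hg).mul (Measurable.mul ?_ (measurable_ofReal.pow_const _))
  exact ((measurable_ofReal.comp Real.measurable_log).neg).pow_const n

/-- `(log x)^n ≤ (n/δ)^n x^δ` for `x ≥ 1`, `δ > 0` (from `log x ≤ x^ε/ε` with `ε = δ/n`). [folklore] -/
theorem pow_log_le_mul_rpow {x δ : ℝ} (hx : 1 ≤ x) (hδ : 0 < δ) (n : ℕ) :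
    Real.log x ^ n ≤ ((n : ℝ) / δ) ^ n * x ^ δ := by
  have hx0 : 0 ≤ x := zero_le_one.trans hx
  rcases Nat.eq_zero_or_pos n with rfl | hn
  · simp only [pow_zero, one_mul]
    exact Real.one_le_rpow hx hδ.le
  · have hn' : (0 : ℝ) < n := by exact_mod_cast hn
    have hε : 0 < δ / n := div_pos hδ hn'
    have h1 : Real.log x ≤ x ^ (δ / n) / (δ / n) := Real.log_le_rpow_div hx0 hε
    have h2 : x ^ (δ / n) / (δ / n) = (n / δ) * x ^ (δ / n) := by
      field_simp
    rw [h2] at h1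
    have hlog0 : 0 ≤ Real.log x := Real.log_nonneg hx
    calc Real.log x ^ n ≤ ((n / δ) * x ^ (δ / n)) ^ n := pow_le_pow_left₀ hlog0 h1 n
      _ = ((n : ℝ) / δ) ^ n * x ^ δ := by
          rw [mul_pow, ← Real.rpow_natCast (x ^ (δ / n)) n, ← Real.rpow_mul hx0]
          congr 2
          field_simp

/-- Norm of the integrand for `x > 1`: `|g x| (log x)^n x^{-(Re s + 1)}`. [folklore] -/
theorem norm_mellinIntegrand {x : ℝ} (hx : 1 < x) (n : ℕ) (s : ℂ) :
    ‖mellinIntegrand g n s x‖ = |g x| * (Real.log x ^ n * x ^ (-(s.re + 1))) := by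
  have hx0 : 0 < x := zero_lt_one.trans hx
  unfold mellinIntegrand
  rw [norm_mul, norm_mul, norm_pow, norm_neg, Complex.norm_real, Complex.norm_real,
    Real.norm_eq_abs, Real.norm_eq_abs, abs_of_nonneg (Real.log_nonneg hx.le),
    norm_cpow_eq_rpow_re_of_pos hx0]
  simp

/-- Domination: for `σ₁ < σ' ≤ Re s` and `x > 1`,
`‖g (-log x)^n x^{-(s+1)}‖ ≤ (n/(σ'-σ₁))^n |g x| x^{-(σ₁+1)}`. [folklore] -/
theorem norm_mellinIntegrand_le {σ₁ σ' : ℝ} (hσ : σ₁ < σ') {s : ℂ} (hs : σ' ≤ s.re) {x : ℝ}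
    (hx : 1 < x) (n : ℕ) :
    ‖mellinIntegrand g n s x‖ ≤ ((n : ℝ) / (σ' - σ₁)) ^ n * (|g x| * x ^ (-(σ₁ + 1))) := by
  have hx0 : 0 < x := zero_lt_one.trans hx
  rw [norm_mellinIntegrand hx]
  have hδ : 0 < σ' - σ₁ := sub_pos.2 hσ
  have h1 : Real.log x ^ n ≤ ((n : ℝ) / (σ' - σ₁)) ^ n * x ^ (σ' - σ₁) :=
    pow_log_le_mul_rpow hx.le hδ n
  have h2 : x ^ (-(s.re + 1)) ≤ x ^ (-(σ' + 1)) :=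
    Real.rpow_le_rpow_of_exponent_le hx.le (by linarith)
  calc |g x| * (Real.log x ^ n * x ^ (-(s.re + 1)))
      ≤ |g x| * ((((n : ℝ) / (σ' - σ₁)) ^ n * x ^ (σ' - σ₁)) * x ^ (-(σ' + 1))) := by
        gcongr
    _ = ((n : ℝ) / (σ' - σ₁)) ^ n * (|g x| * x ^ (-(σ₁ + 1))) := by
        rw [mul_assoc, ← Real.rpow_add hx0, show σ' - σ₁ + -(σ' + 1) = -(σ₁ + 1) by ring]
        ring

/-- If `∫_1^∞ |g| x^{-(σ₁+1)} < ∞` then `g (-log x)^n x^{-(s+1)}` is integrable on `(1, ∞)` for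
`Re s > σ₁`. [cite: MontgomeryVaughan2007, §15.1 Lemma 15.1] -/
theorem integrable_mellinIntegrand (hg : Measurable g) {σ₁ : ℝ}
    (hint : IntegrableOn (fun x ↦ g x * x ^ (-(σ₁ + 1))) (Ioi 1)) (n : ℕ) {s : ℂ}
    (hs : σ₁ < s.re) :
    Integrable (mellinIntegrand g n s) (volume.restrict (Ioi 1)) := by
  set σ' := s.re
  have hC : Integrable (fun x ↦ ((n : ℝ) / (σ' - σ₁)) ^ n * (|g x| * x ^ (-(σ₁ + 1))))
      (volume.restrict (Ioi 1)) := by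
    have h1 : Integrable (fun x ↦ |g x| * x ^ (-(σ₁ + 1))) (volume.restrict (Ioi 1)) := by
      have := hint.norm
      refine this.congr ?_
      rw [Filter.EventuallyEq, ae_restrict_iff' measurableSet_Ioi]
      refine Eventually.of_forall fun x (hx : 1 < x) ↦ ?_
      have hx0 : 0 < x := zero_lt_one.trans hx
      rw [norm_mul, Real.norm_eq_abs, Real.norm_eq_abs, abs_of_pos (Real.rpow_pos_of_pos hx0 _)]
    exact h1.const_mul _
  refine Integrable.mono' hC (measurable_mellinIntegrand hg n s).aestronglyMeasurable ?_
  rw [ae_restrict_iff' measurableSet_Ioi]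
  exact Eventually.of_forall fun x hx ↦ norm_mellinIntegrand_le hs le_rfl hx n

/-- **Differentiation under the integral sign** (MV Lemma 15.1, "the function `F(s)` is analytic
in the half-plane"): for `Re s₀ > σ₁`,
`d/ds ∫ g (-log x)^n x^{-(s+1)} = ∫ g (-log x)^{n+1} x^{-(s+1)}` at `s₀`.
[cite: MontgomeryVaughan2007, §15.1 Lemma 15.1] -/
theorem hasDerivAt_mellinIoiLog (hg : Measurable g) {σ₁ : ℝ}
    (hint : IntegrableOn (fun x ↦ g x * x ^ (-(σ₁ + 1))) (Ioi 1)) (n : ℕ) {s₀ : ℂ}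
    (hs₀ : σ₁ < s₀.re) :
    HasDerivAt (mellinIoiLog g n) (mellinIoiLog g (n + 1) s₀) s₀ := by
  set δ : ℝ := (s₀.re - σ₁) / 2 with hδ
  have hδ0 : 0 < δ := by rw [hδ]; linarith
  set σ' : ℝ := σ₁ + δ with hσ'
  have hσ'1 : σ₁ < σ' := by rw [hσ']; linarith
  have hball : Metric.ball s₀ δ ∈ 𝓝 s₀ := Metric.ball_mem_nhds _ hδ0
  have hre : ∀ s ∈ Metric.ball s₀ δ, σ' ≤ s.re := by
    intro s hs
    have h1 : |(s - s₀).re| ≤ ‖s - s₀‖ := abs_re_le_norm _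
    have h2 : ‖s - s₀‖ < δ := by simpa [dist_eq_norm] using hs
    have h3 : |s.re - s₀.re| < δ := by simpa using h1.trans_lt h2
    have := (abs_lt.mp h3).1
    rw [hσ']
    linarith
  set C : ℝ := (((n + 1 : ℕ) : ℝ) / (σ' - σ₁)) ^ (n + 1) with hCdef
  set bound : ℝ → ℝ := fun x ↦ C * (|g x| * x ^ (-(σ₁ + 1))) with hbound
  have key := hasDerivAt_integral_of_dominated_loc_of_deriv_le
    (μ := volume.restrict (Ioi (1 : ℝ))) (F := fun s x ↦ mellinIntegrand g n s x)
    (F' := fun s x ↦ mellinIntegrand g (n + 1) s x) (x₀ := s₀) (bound := bound)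
    hball ?meas ?int ?meas' ?bd ?bdint ?diff
  · exact key.2
  case meas =>
    exact Eventually.of_forall fun s ↦ (measurable_mellinIntegrand hg n s).aestronglyMeasurable
  case int => exact integrable_mellinIntegrand hg hint n hs₀
  case meas' => exact (measurable_mellinIntegrand hg (n + 1) s₀).aestronglyMeasurable
  case bd =>
    rw [ae_restrict_iff' measurableSet_Ioi]
    refine Eventually.of_forall fun x (hx : 1 < x) s hs ↦ ?_
    exact norm_mellinIntegrand_le hσ'1 (hre s hs) hx (n + 1)
  case bdint =>
    have h1 : Integrable (fun x ↦ |g x| * x ^ (-(σ₁ + 1))) (volume.restrict (Ioi 1)) := by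
      have := hint.norm
      refine this.congr ?_
      rw [Filter.EventuallyEq, ae_restrict_iff' measurableSet_Ioi]
      refine Eventually.of_forall fun x (hx : 1 < x) ↦ ?_
      have hx0 : 0 < x := zero_lt_one.trans hx
      rw [norm_mul, Real.norm_eq_abs, Real.norm_eq_abs, abs_of_pos (Real.rpow_pos_of_pos hx0 _)]
    exact h1.const_mul _
  case diff =>
    rw [ae_restrict_iff' measurableSet_Ioi]
    refine Eventually.of_forall fun x (hx : 1 < x) s _ ↦ ?_
    have hx' : (x : ℂ) ≠ 0 := ofReal_ne_zero.mpr (zero_lt_one.trans hx).ne'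
    have h1 : HasDerivAt (fun s : ℂ ↦ -(s + 1)) (-1) s :=
      ((hasDerivAt_id s).add_const (1 : ℂ)).neg
    have h2 := ((h1.const_cpow (c := (x : ℂ)) (Or.inl hx')).const_mul
      ((-(Real.log x : ℂ)) ^ n)).const_mul (g x : ℂ)
    have h3 : (g x : ℂ) * ((-(Real.log x : ℂ)) ^ n * ((x : ℂ) ^ (-(s + 1)) * Complex.log x * (-1)))
        = mellinIntegrand g (n + 1) s x := by
      unfold mellinIntegrand
      rw [(Complex.ofReal_log (zero_lt_one.trans hx).le).symm, pow_succ]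
      ring
    rw [h3] at h2
    exact h2

/-- The transform with `n` logarithms is holomorphic on `Re s > σ₁`. [cite: MontgomeryVaughan2007, §15.1 Lemma 15.1] -/
theorem differentiableOn_mellinIoiLog (hg : Measurable g) {σ₁ : ℝ}
    (hint : IntegrableOn (fun x ↦ g x * x ^ (-(σ₁ + 1))) (Ioi 1)) (n : ℕ) :
    DifferentiableOn ℂ (mellinIoiLog g n) {s : ℂ | σ₁ < s.re} :=
  fun _ hs ↦ (hasDerivAt_mellinIoiLog hg hint n hs).differentiableAt.differentiableWithinAt

/-- **MV Lemma 15.1, first half**: `F(s) = ∫_1^∞ g x^{-(s+1)} dx` is holomorphic on the half-plane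
`Re s > σ₁` of absolute convergence. [cite: MontgomeryVaughan2007, §15.1 Lemma 15.1] -/
theorem differentiableOn_mellinIoi (hg : Measurable g) {σ₁ : ℝ}
    (hint : IntegrableOn (fun x ↦ g x * x ^ (-(σ₁ + 1))) (Ioi 1)) :
    DifferentiableOn ℂ (mellinIoi g) {s : ℂ | σ₁ < s.re} := by
  rw [← mellinIoiLog_zero]
  exact differentiableOn_mellinIoiLog hg hint 0

/-- The open half-plane `Re s > σ`. [folklore] -/
theorem isOpen_re_gt (σ : ℝ) : IsOpen {s : ℂ | σ < s.re} :=
  isOpen_lt continuous_const continuous_re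

/-- Iterated derivatives of the transform: `F^{(k)}(s) = ∫ g (-log x)^k x^{-(s+1)} dx` on
`Re s > σ₁`, and more generally for `mellinIoiLog g n`. [cite: MontgomeryVaughan2007, §15.1 Lemma 15.1] -/
theorem iteratedDeriv_mellinIoiLog (hg : Measurable g) {σ₁ : ℝ}
    (hint : IntegrableOn (fun x ↦ g x * x ^ (-(σ₁ + 1))) (Ioi 1)) (k n : ℕ) {s : ℂ}
    (hs : σ₁ < s.re) :
    iteratedDeriv k (mellinIoiLog g n) s = mellinIoiLog g (n + k) s := by
  induction k generalizing n s with
  | zero => simp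
  | succ k ih =>
    rw [iteratedDeriv_succ']
    have hev : deriv (mellinIoiLog g n) =ᶠ[𝓝 s] mellinIoiLog g (n + 1) := by
      filter_upwards [(isOpen_re_gt σ₁).mem_nhds hs] with s' hs'
      exact (hasDerivAt_mellinIoiLog hg hint n hs').deriv
    rw [(hev.iteratedDeriv_eq k), ih (n + 1) hs]
    congr 1
    ring

/-- Iterated derivatives of `F` itself. [cite: MontgomeryVaughan2007, §15.1 Lemma 15.1] -/
theorem iteratedDeriv_mellinIoi (hg : Measurable g) {σ₁ : ℝ}
    (hint : IntegrableOn (fun x ↦ g x * x ^ (-(σ₁ + 1))) (Ioi 1)) (k : ℕ) {s : ℂ}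
    (hs : σ₁ < s.re) :
    iteratedDeriv k (mellinIoi g) s = mellinIoiLog g k s := by
  rw [← mellinIoiLog_zero, iteratedDeriv_mellinIoiLog hg hint k 0 hs, zero_add]

/-- Absolute convergence is monotone in `σ`: convergence at `σ₁` gives convergence at every
`σ ≥ σ₁`. [folklore] -/
theorem integrableOn_rpow_of_le (hg : Measurable g) {σ₁ σ : ℝ} (hσ : σ₁ ≤ σ)
    (hint : IntegrableOn (fun x ↦ g x * x ^ (-(σ₁ + 1))) (Ioi 1)) :
    IntegrableOn (fun x ↦ g x * x ^ (-(σ + 1))) (Ioi 1) := by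
  refine Integrable.mono' hint.norm ?_ ?_
  · exact ((hg.mul (measurable_id.pow_const _))).aestronglyMeasurable
  · rw [ae_restrict_iff' measurableSet_Ioi]
    refine Eventually.of_forall fun x (hx : 1 < x) ↦ ?_
    have hx0 : 0 < x := zero_lt_one.trans hx
    rw [norm_mul, norm_mul, Real.norm_eq_abs, Real.norm_eq_abs, Real.norm_eq_abs,
      abs_of_pos (Real.rpow_pos_of_pos hx0 _), abs_of_pos (Real.rpow_pos_of_pos hx0 _)]
    exact mul_le_mul_of_nonneg_left
      (Real.rpow_le_rpow_of_exponent_le hx.le (by linarith)) (abs_nonneg _)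

/-- The trivial bound `‖F(s)‖ ≤ ∫_1^∞ |g(x)| x^{-(σ'+1)} dx` for `Re s ≥ σ'` (MV, proof of Thm. 15.3:
"the integral … is uniformly bounded"). [cite: MontgomeryVaughan2007, §15.1 (proof of Thm. 15.3)] -/
theorem norm_mellinIoi_le {σ' : ℝ} {s : ℂ} (hs : σ' ≤ s.re)
    (hint : IntegrableOn (fun x ↦ g x * x ^ (-(σ' + 1))) (Ioi 1)) :
    ‖mellinIoi g s‖ ≤ ∫ x in Ioi (1 : ℝ), |g x| * x ^ (-(σ' + 1)) := by
  unfold mellinIoi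
  refine (norm_integral_le_integral_norm _).trans (integral_mono_of_nonneg ?_ ?_ ?_)
  · exact Eventually.of_forall fun _ ↦ norm_nonneg _
  · have := hint.norm
    refine this.congr ?_
    rw [Filter.EventuallyEq, ae_restrict_iff' measurableSet_Ioi]
    refine Eventually.of_forall fun x (hx : 1 < x) ↦ ?_
    have hx0 : 0 < x := zero_lt_one.trans hx
    rw [norm_mul, Real.norm_eq_abs, Real.norm_eq_abs, abs_of_pos (Real.rpow_pos_of_pos hx0 _)]
  · rw [Filter.EventuallyLE, ae_restrict_iff' measurableSet_Ioi]
    refine Eventually.of_forall fun x (hx : 1 < x) ↦ ?_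
    have hx0 : 0 < x := zero_lt_one.trans hx
    rw [norm_mul, Complex.norm_real, Real.norm_eq_abs, norm_cpow_eq_rpow_re_of_pos hx0]
    refine mul_le_mul_of_nonneg_left (Real.rpow_le_rpow_of_exponent_le hx.le ?_) (abs_nonneg _)
    simp only [neg_add_rev, add_re, neg_re, one_re]
    linarith

/-! ### Real-valued integrands with logarithms -/

/-- The real integrand `g(x) (log x)^n x^{-(σ'+1)}` is integrable on `(1,∞)` for `σ' > σ₁`.
[cite: MontgomeryVaughan2007, §15.1 Lemma 15.1] -/
theorem integrable_logpow_rpow (hg : Measurable g) {σ₁ : ℝ}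
    (hint : IntegrableOn (fun x ↦ g x * x ^ (-(σ₁ + 1))) (Ioi 1)) (n : ℕ) {σ' : ℝ}
    (hσ' : σ₁ < σ') :
    Integrable (fun x ↦ g x * Real.log x ^ n * x ^ (-(σ' + 1))) (volume.restrict (Ioi 1)) := by
  have hC : Integrable (fun x ↦ ((n : ℝ) / (σ' - σ₁)) ^ n * (|g x| * x ^ (-(σ₁ + 1))))
      (volume.restrict (Ioi 1)) := by
    have h1 : Integrable (fun x ↦ |g x| * x ^ (-(σ₁ + 1))) (volume.restrict (Ioi 1)) := by
      refine hint.norm.congr ?_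
      rw [Filter.EventuallyEq, ae_restrict_iff' measurableSet_Ioi]
      refine Eventually.of_forall fun x (hx : 1 < x) ↦ ?_
      have hx0 : 0 < x := zero_lt_one.trans hx
      rw [norm_mul, Real.norm_eq_abs, Real.norm_eq_abs, abs_of_pos (Real.rpow_pos_of_pos hx0 _)]
    exact h1.const_mul _
  refine Integrable.mono' hC ?_ ?_
  · exact ((hg.mul (Real.measurable_log.pow_const n)).mul
      (measurable_id.pow_const _)).aestronglyMeasurable
  · rw [ae_restrict_iff' measurableSet_Ioi]
    refine Eventually.of_forall fun x (hx : 1 < x) ↦ ?_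
    have hx0 : 0 < x := zero_lt_one.trans hx
    have hδ : 0 < σ' - σ₁ := sub_pos.2 hσ'
    have h1 : Real.log x ^ n ≤ ((n : ℝ) / (σ' - σ₁)) ^ n * x ^ (σ' - σ₁) :=
      pow_log_le_mul_rpow hx.le hδ n
    rw [norm_mul, norm_mul, Real.norm_eq_abs, Real.norm_eq_abs, Real.norm_eq_abs,
      abs_of_nonneg (pow_nonneg (Real.log_nonneg hx.le) n),
      abs_of_pos (Real.rpow_pos_of_pos hx0 _)]
    calc |g x| * Real.log x ^ n * x ^ (-(σ' + 1))
        ≤ |g x| * (((n : ℝ) / (σ' - σ₁)) ^ n * x ^ (σ' - σ₁)) * x ^ (-(σ' + 1)) := by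
          gcongr
      _ = ((n : ℝ) / (σ' - σ₁)) ^ n * (|g x| * x ^ (-(σ₁ + 1))) := by
          rw [mul_assoc, mul_assoc, ← Real.rpow_add hx0,
            show σ' - σ₁ + -(σ' + 1) = -(σ₁ + 1) by ring]
          ring

/-- The complex transform with logarithms at a real point is the real integral:
`mellinIoiLog g n σ = (-1)^n ∫ g (log x)^n x^{-(σ+1)} dx`. [folklore] -/
theorem mellinIoiLog_ofReal (n : ℕ) (σ : ℝ) :
    mellinIoiLog g n (σ : ℂ) =
      (((-1 : ℝ) ^ n * ∫ x in Ioi (1 : ℝ), g x * Real.log x ^ n * x ^ (-(σ + 1)) : ℝ) : ℂ) := by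
  unfold mellinIoiLog
  rw [ofReal_mul, ← integral_complex_ofReal, ← integral_const_mul]
  refine setIntegral_congr_fun measurableSet_Ioi fun x hx ↦ ?_
  have hx0 : 0 < x := zero_lt_one.trans hx
  unfold mellinIntegrand
  have hpow : (x : ℂ) ^ (-((σ : ℂ) + 1)) = ((x ^ (-(σ + 1)) : ℝ) : ℂ) := by
    rw [Complex.ofReal_cpow hx0.le]
    push_cast
    ring_nf
  rw [hpow]
  push_cast
  ring

/-! ### Landau's lemma: the Tonelli step -/

/-- **Monotone convergence step** in Landau's argument (MV, proof of Thm. 1.7: "since all terms are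
non-negative, the order of summation and integration may be exchanged"): if `g ≥ 0` on `(X₁, ∞)`
and the series `∑_n ∫_{X₁}^∞ g (R' log x)^n/n! · x^{-(σ₂+1)} dx` converges, then
`∫_{X₁}^∞ g x^{-(σ₂ - R' + 1)} dx` converges. [cite: MontgomeryVaughan2007, §1.2 Thm. 1.7 (proof)] -/
theorem integrableOn_of_summable_integral_logpow (hg : Measurable g) {X₁ R' σ₂ : ℝ} (hX₁ : 1 ≤ X₁)
    (hpos : ∀ x, X₁ < x → 0 ≤ g x) (hR' : 0 ≤ R')
    (hu : ∀ n : ℕ, IntegrableOn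
      (fun x ↦ g x * ((R' * Real.log x) ^ n / n.factorial) * x ^ (-(σ₂ + 1))) (Ioi X₁))
    (hsum : Summable fun n : ℕ ↦
      ∫ x in Ioi X₁, g x * ((R' * Real.log x) ^ n / n.factorial) * x ^ (-(σ₂ + 1))) :
    IntegrableOn (fun x ↦ g x * x ^ (-(σ₂ - R' + 1))) (Ioi X₁) := by
  set u : ℕ → ℝ → ℝ := fun n x ↦ g x * ((R' * Real.log x) ^ n / n.factorial) * x ^ (-(σ₂ + 1))
    with hu_def
  set φ : ℝ → ℝ := fun x ↦ g x * x ^ (-(σ₂ - R' + 1)) with hφ_def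
  -- pointwise: `∑ u n x = φ x` and `u n x ≥ 0` on `(X₁, ∞)`
  have hu_nonneg : ∀ n x, X₁ < x → 0 ≤ u n x := by
    intro n x hx
    have hx1 : 1 < x := lt_of_le_of_lt hX₁ hx
    have hx0 : 0 < x := zero_lt_one.trans hx1
    have h1 : 0 ≤ (R' * Real.log x) ^ n / n.factorial :=
      div_nonneg (pow_nonneg (mul_nonneg hR' (Real.log_nonneg hx1.le)) n) (Nat.cast_nonneg _)
    exact mul_nonneg (mul_nonneg (hpos x hx) h1) (Real.rpow_pos_of_pos hx0 _).le
  have hu_hasSum : ∀ x, X₁ < x → HasSum (fun n ↦ u n x) (φ x) := by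
    intro x hx
    have hx1 : 1 < x := lt_of_le_of_lt hX₁ hx
    have hx0 : 0 < x := zero_lt_one.trans hx1
    have h1 : HasSum (fun n : ℕ ↦ (R' * Real.log x) ^ n / n.factorial) (Real.exp (R' * Real.log x)) := by
      rw [Real.exp_eq_exp_ℝ]
      exact NormedSpace.expSeries_div_hasSum_exp (R' * Real.log x)
    have h2 : Real.exp (R' * Real.log x) = x ^ R' := by
      rw [Real.rpow_def_of_pos hx0, mul_comm]
    rw [h2] at h1
    have h3 := (h1.mul_left (g x)).mul_right (x ^ (-(σ₂ + 1)))
    have h4 : g x * x ^ R' * x ^ (-(σ₂ + 1)) = φ x := by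
      simp only [hφ_def]
      rw [mul_assoc, ← Real.rpow_add hx0]
      congr 2
      ring
    rw [h4] at h3
    exact h3
  have hφ_nonneg : ∀ x, X₁ < x → 0 ≤ φ x := fun x hx ↦
    (hu_hasSum x hx).nonneg (fun n ↦ hu_nonneg n x hx)
  have hφ_meas : Measurable φ := hg.mul (measurable_id.pow_const _)
  have hu_meas : ∀ n, Measurable (u n) := fun n ↦
    (hg.mul (((Real.measurable_log.const_mul R').pow_const n).div_const _)).mul
      (measurable_id.pow_const _)
  -- integrals of the `u n` are non-negative
  have hI_nonneg : ∀ n, 0 ≤ ∫ x in Ioi X₁, u n x := fun n ↦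
    setIntegral_nonneg measurableSet_Ioi (fun x hx ↦ hu_nonneg n x hx)
  -- the lower Lebesgue integral of `φ` is the sum of the integrals of the `u n`
  have hlin : ∫⁻ x in Ioi X₁, ENNReal.ofReal (φ x) = ENNReal.ofReal (∑' n, ∫ x in Ioi X₁, u n x) := by
    have h1 : ∫⁻ x in Ioi X₁, ENNReal.ofReal (φ x)
        = ∫⁻ x in Ioi X₁, ∑' n, ENNReal.ofReal (u n x) := by
      refine setLIntegral_congr_fun measurableSet_Ioi fun x hx ↦ ?_
      rw [← (hu_hasSum x hx).tsum_eq]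
      exact ENNReal.ofReal_tsum_of_nonneg (fun n ↦ hu_nonneg n x hx) (hu_hasSum x hx).summable
    rw [h1, lintegral_tsum fun n ↦ ((hu_meas n).ennreal_ofReal).aemeasurable]
    rw [ENNReal.ofReal_tsum_of_nonneg hI_nonneg hsum]
    congr 1
    funext n
    rw [ofReal_integral_eq_lintegral_ofReal (hu n)]
    rw [Filter.EventuallyLE, ae_restrict_iff' measurableSet_Ioi]
    exact Eventually.of_forall fun x hx ↦ hu_nonneg n x hx
  refine ⟨hφ_meas.aestronglyMeasurable, ?_⟩
  rw [hasFiniteIntegral_iff_ofReal]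
  · rw [hlin]
    exact ENNReal.ofReal_lt_top
  · rw [Filter.EventuallyLE, ae_restrict_iff' measurableSet_Ioi]
    exact Eventually.of_forall fun x hx ↦ hφ_nonneg x hx

/-- Convergence at `σ` on `(X₁, ∞)` plus convergence at some `σ₁` on `(1, ∞)` gives convergence at
`σ` on `(1, ∞)` (the finite part `(1, X₁]` is harmless). [folklore] -/
theorem integrableOn_Ioi_one_of_Ioi {X₁ σ₁ σ : ℝ} (hX₁ : 1 ≤ X₁)
    (hint : IntegrableOn (fun x ↦ g x * x ^ (-(σ₁ + 1))) (Ioi 1))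
    (hX : IntegrableOn (fun x ↦ g x * x ^ (-(σ + 1))) (Ioi X₁)) :
    IntegrableOn (fun x ↦ g x * x ^ (-(σ + 1))) (Ioi 1) := by
  rw [← Ioc_union_Ioi_eq_Ioi hX₁]
  refine IntegrableOn.union ?_ hX
  -- on `(1, X₁]`: `g x^{-(σ+1)} = (g x^{-(σ₁+1)}) · x^{σ₁ - σ}` with a bounded second factor
  have h1 : IntegrableOn (fun x ↦ g x * x ^ (-(σ₁ + 1))) (Ioc 1 X₁) :=
    hint.mono_set Ioc_subset_Ioi_self
  set C : ℝ := max 1 (X₁ ^ (σ₁ - σ)) with hC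
  have h2 : IntegrableOn (fun x ↦ (g x * x ^ (-(σ₁ + 1))) * x ^ (σ₁ - σ)) (Ioc 1 X₁) := by
    refine Integrable.mul_bdd (c := C) h1 (measurable_id.pow_const _).aestronglyMeasurable ?_
    rw [ae_restrict_iff' measurableSet_Ioc]
    refine Eventually.of_forall fun x hx ↦ ?_
    have hx0 : 0 < x := zero_lt_one.trans hx.1
    rw [Real.norm_eq_abs, abs_of_pos (Real.rpow_pos_of_pos hx0 _)]
    rcases le_or_gt 0 (σ₁ - σ) with h | h
    · exact (Real.rpow_le_rpow hx0.le hx.2 h).trans (le_max_right _ _)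
    · exact (Real.rpow_le_one_of_one_le_of_nonpos hx.1.le h.le).trans (le_max_left _ _)
  refine h2.congr_fun (fun x hx ↦ ?_) measurableSet_Ioc
  have hx0 : 0 < x := zero_lt_one.trans hx.1
  simp only
  rw [mul_assoc, ← Real.rpow_add hx0]
  congr 2
  ring

/-! ### Landau's lemma, disc form -/

/-- **Landau's lemma, disc form** (MV Lemma 15.1; the proof of Thm. 1.7 adapted to integrals).
Let `g` be measurable with `∫_1^∞ |g| x^{-(σ₁+1)} dx < ∞` and `g ≥ 0` on `(X₁, ∞)`. If the
transform `F(s) = ∫_1^∞ g x^{-(s+1)} dx` agrees near the real point `σ₂ > σ₁` with a function `Φ`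
holomorphic on the disc `|s - σ₂| < R`, then `∫_1^∞ g x^{-(σ+1)} dx` converges (absolutely) for
every real `σ > σ₂ - R`. (So the abscissa of convergence is a singularity of `F`.)
[cite: MontgomeryVaughan2007, §15.1 Lemma 15.1] -/
theorem integrableOn_of_differentiableOn_ball (hg : Measurable g) {σ₁ σ₂ R X₁ : ℝ}
    (hint : IntegrableOn (fun x ↦ g x * x ^ (-(σ₁ + 1))) (Ioi 1))
    (hX₁ : 1 ≤ X₁) (hpos : ∀ x, X₁ < x → 0 ≤ g x) (h12 : σ₁ < σ₂) {Φ : ℂ → ℂ}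
    (hΦ : DifferentiableOn ℂ Φ (Metric.ball (σ₂ : ℂ) R))
    (hagree : Φ =ᶠ[𝓝 (σ₂ : ℂ)] mellinIoi g) {σ : ℝ} (hσ : σ₂ - R < σ) :
    IntegrableOn (fun x ↦ g x * x ^ (-(σ + 1))) (Ioi 1) := by
  by_cases hσ1 : σ₁ ≤ σ
  · exact integrableOn_rpow_of_le hg hσ1 hint
  push Not at hσ1
  set R' : ℝ := σ₂ - σ with hR'
  have hR'0 : 0 < R' := by rw [hR']; linarith
  have hR'R : R' < R := by rw [hR']; linarith
  -- the Taylor series of `Φ` at `σ₂` converges at the real point `σ = σ₂ - R'`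
  have hz : ((σ : ℝ) : ℂ) ∈ Metric.ball (σ₂ : ℂ) R := by
    rw [Metric.mem_ball, dist_eq_norm, ← ofReal_sub, Complex.norm_real, Real.norm_eq_abs,
      show σ - σ₂ = -R' by rw [hR']; ring, abs_neg, abs_of_pos hR'0]
    exact hR'R
  have hT := Complex.hasSum_taylorSeries_on_ball hΦ hz
  -- its terms are the real numbers `a n = ∫_1^∞ g (R' log x)^n/n! x^{-(σ₂+1)} dx`
  set b : ℕ → ℝ := fun n ↦ ∫ x in Ioi (1 : ℝ), g x * Real.log x ^ n * x ^ (-(σ₂ + 1)) with hb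
  set a : ℕ → ℝ := fun n ↦ R' ^ n / n.factorial * b n with ha
  have hσ₂ : σ₁ < ((σ₂ : ℝ) : ℂ).re := by simpa using h12
  have hterm : ∀ n : ℕ, ((n.factorial : ℂ)⁻¹ • (((σ : ℝ) : ℂ) - (σ₂ : ℂ)) ^ n •
      iteratedDeriv n Φ (σ₂ : ℂ)) = ((a n : ℝ) : ℂ) := by
    intro n
    rw [(hagree.iteratedDeriv_eq n), iteratedDeriv_mellinIoi hg hint n hσ₂,
      mellinIoiLog_ofReal n σ₂]
    have h1 : (((σ : ℝ) : ℂ) - (σ₂ : ℂ)) = ((-R' : ℝ) : ℂ) := by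
      rw [hR']
      push_cast
      ring
    rw [h1, smul_eq_mul, smul_eq_mul]
    simp only [ha]
    push_cast
    have h2 : ((-R' : ℂ)) ^ n * (-1) ^ n = (R' : ℂ) ^ n := by
      rw [← mul_pow]; congr 1; ring
    calc ((n.factorial : ℂ))⁻¹ * ((-(R' : ℂ)) ^ n * ((-1) ^ n * (b n : ℂ)))
        = ((n.factorial : ℂ))⁻¹ * (((-(R' : ℂ)) ^ n * (-1) ^ n) * (b n : ℂ)) := by ring
      _ = (R' : ℂ) ^ n / (n.factorial : ℂ) * (b n : ℂ) := by rw [h2]; ring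
  have hsumC : Summable fun n : ℕ ↦ ((a n : ℝ) : ℂ) := by
    have := hT.summable
    simpa only [hterm] using this
  have hsum_a : Summable a := Complex.summable_ofReal.mp hsumC
  -- `a n = h n + t n`: split the integrals at `X₁`
  set u : ℕ → ℝ → ℝ := fun n x ↦ g x * ((R' * Real.log x) ^ n / n.factorial) * x ^ (-(σ₂ + 1))
    with hu
  have hu_int : ∀ n, IntegrableOn (u n) (Ioi 1) := by
    intro n
    have := (integrable_logpow_rpow hg hint n h12).const_mul (R' ^ n / n.factorial)
    refine this.congr (Eventually.of_forall fun x ↦ ?_)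
    simp only [hu]
    rw [mul_pow]
    ring
  have ha_eq : ∀ n, a n = ∫ x in Ioi (1 : ℝ), u n x := by
    intro n
    simp only [ha, hb, hu]
    rw [← integral_const_mul]
    refine setIntegral_congr_fun measurableSet_Ioi fun x _ ↦ ?_
    rw [mul_pow]
    ring
  set h : ℕ → ℝ := fun n ↦ ∫ x in Ioc 1 X₁, u n x with hh
  set t : ℕ → ℝ := fun n ↦ ∫ x in Ioi X₁, u n x with ht
  have hsplit : ∀ n, a n = h n + t n := by
    intro n
    rw [ha_eq n, ← Ioc_union_Ioi_eq_Ioi hX₁]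
    exact setIntegral_union (Set.Ioc_disjoint_Ioi le_rfl) measurableSet_Ioi
      ((hu_int n).mono_set Ioc_subset_Ioi_self) ((hu_int n).mono_set (Ioi_subset_Ioi hX₁))
  -- the head part is absolutely summable: `|h n| ≤ M (R' log X₁)^n / n!`
  set M : ℝ := ∫ x in Ioc 1 X₁, |g x| * x ^ (-(σ₂ + 1)) with hM
  have hgabs : IntegrableOn (fun x ↦ |g x| * x ^ (-(σ₂ + 1))) (Ioc 1 X₁) := by
    have h1 : IntegrableOn (fun x ↦ g x * x ^ (-(σ₂ + 1))) (Ioi 1) :=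
      integrableOn_rpow_of_le hg h12.le hint
    have h2 : IntegrableOn (fun x ↦ ‖g x * x ^ (-(σ₂ + 1))‖) (Ioc 1 X₁) :=
      (h1.mono_set (Ioc_subset_Ioi_self : Ioc (1 : ℝ) X₁ ⊆ Ioi 1)).norm
    refine h2.congr_fun (fun x hx ↦ ?_) measurableSet_Ioc
    have hx0 : 0 < x := zero_lt_one.trans hx.1
    simp only
    rw [norm_mul, Real.norm_eq_abs, Real.norm_eq_abs, abs_of_pos (Real.rpow_pos_of_pos hx0 _)]
  have hh_bound : ∀ n, ‖h n‖ ≤ M * ((R' * Real.log X₁) ^ n / n.factorial) := by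
    intro n
    have hlogX : 0 ≤ Real.log X₁ := Real.log_nonneg hX₁
    calc ‖h n‖ ≤ ∫ x in Ioc 1 X₁, ((R' * Real.log X₁) ^ n / n.factorial) * (|g x| * x ^ (-(σ₂ + 1))) := by
          refine norm_integral_le_of_norm_le (hgabs.const_mul _) ?_
          rw [ae_restrict_iff' measurableSet_Ioc]
          refine Eventually.of_forall fun x hx ↦ ?_
          have hx0 : 0 < x := zero_lt_one.trans hx.1
          have hlx : 0 ≤ Real.log x := Real.log_nonneg hx.1.le
          have hlxX : Real.log x ≤ Real.log X₁ := Real.log_le_log hx0 hx.2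
          simp only [hu]
          rw [norm_mul, norm_mul, Real.norm_eq_abs, Real.norm_eq_abs, Real.norm_eq_abs,
            abs_of_pos (Real.rpow_pos_of_pos hx0 _),
            abs_of_nonneg (div_nonneg (pow_nonneg (mul_nonneg hR'0.le hlx) n) (Nat.cast_nonneg _))]
          have : (R' * Real.log x) ^ n / n.factorial ≤ (R' * Real.log X₁) ^ n / n.factorial := by
            gcongr
          calc |g x| * ((R' * Real.log x) ^ n / n.factorial) * x ^ (-(σ₂ + 1))
              ≤ |g x| * ((R' * Real.log X₁) ^ n / n.factorial) * x ^ (-(σ₂ + 1)) := by gcongr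
            _ = (R' * Real.log X₁) ^ n / n.factorial * (|g x| * x ^ (-(σ₂ + 1))) := by ring
      _ = M * ((R' * Real.log X₁) ^ n / n.factorial) := by
          rw [integral_const_mul, hM, mul_comm]
  have hsum_h : Summable h :=
    Summable.of_norm_bounded ((Real.summable_pow_div_factorial (R' * Real.log X₁)).mul_left M)
      hh_bound
  -- hence the tail part is summable, with non-negative terms
  have hsum_t : Summable t := by
    have := hsum_a.sub hsum_h
    refine this.congr fun n ↦ ?_
    rw [hsplit n]
    ring
  -- Tonelli
  have hu_X : ∀ n, IntegrableOn (u n) (Ioi X₁) := fun n ↦ (hu_int n).mono_set (Ioi_subset_Ioi hX₁)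
  have hmain := integrableOn_of_summable_integral_logpow hg hX₁ hpos hR'0.le hu_X hsum_t
  have hσeq : σ₂ - R' = σ := by rw [hR']; ring
  rw [hσeq] at hmain
  exact integrableOn_Ioi_one_of_Ioi hX₁ hint hmain

/-! ### Landau's lemma, abscissa form -/

/-- The transform is holomorphic on `Re s > σ_c` as soon as it converges absolutely at every real
`σ > σ_c`. [cite: MontgomeryVaughan2007, §15.1 Lemma 15.1] -/
theorem differentiableOn_mellinIoi_of_forall (hg : Measurable g) {σc : ℝ}
    (hS : ∀ σ' : ℝ, σc < σ' → IntegrableOn (fun x ↦ g x * x ^ (-(σ' + 1))) (Ioi 1)) :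
    DifferentiableOn ℂ (mellinIoi g) {s : ℂ | σc < s.re} := by
  intro s hs
  have h1 : σc < (σc + s.re) / 2 := by simp only [Set.mem_setOf_eq] at hs; linarith
  have h2 : (σc + s.re) / 2 < s.re := by simp only [Set.mem_setOf_eq] at hs; linarith
  have := hasDerivAt_mellinIoiLog hg (hS _ h1) 0 h2
  rw [mellinIoiLog_zero] at this
  exact this.differentiableAt.differentiableWithinAt

/-- **Landau's lemma, abscissa form** (MV Lemma 15.1 in the form used in the proof of Thm. 15.2:
"the left-hand side has a pole at `Θ − ε` but is analytic for real `s > Θ − ε` … Hence the above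
identity holds for `σ > Θ − ε`, and both sides are analytic in this half-plane"). Let `g` be
measurable, `≥ 0` on `(X₁, ∞)`, with `∫_1^∞ |g| x^{-(σ₁+1)} dx < ∞`. Suppose the transform
`F(s) = ∫_1^∞ g x^{-(s+1)} dx` agrees on `Re s > σ₁` with a function `Φ` holomorphic on
`{Re s > σ₁} ∪ W₀`, where `W₀` is a convex open set containing the real segment `(a, σ₁ + 1]`. Then
the integral converges absolutely at every real `σ > a` (hence `F` is holomorphic on `Re s > a` and
`F = Φ` on the connected part of the common domain). Proof: apply the disc form at the infimum
`σ_c` of the abscissae of convergence in `[a, σ₁]`; if `σ_c > a`, holomorphy of `Φ` on a disc about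
`σ_c` and the identity theorem on `{Re s > σ₁} ∪ (W₀ ∩ {Re s > σ_c})` push the abscissa below `σ_c`.
[cite: MontgomeryVaughan2007, §15.1 Lemma 15.1] -/
theorem integrableOn_of_differentiableOn_union_convex (hg : Measurable g) {σ₁ a X₁ : ℝ}
    (hint : IntegrableOn (fun x ↦ g x * x ^ (-(σ₁ + 1))) (Ioi 1))
    (hX₁ : 1 ≤ X₁) (hpos : ∀ x, X₁ < x → 0 ≤ g x) (ha : a < σ₁)
    {W₀ : Set ℂ} (hW₀o : IsOpen W₀) (hW₀c : Convex ℝ W₀)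
    (hW₀r : ∀ σ : ℝ, a < σ → σ ≤ σ₁ + 1 → (σ : ℂ) ∈ W₀)
    {Φ : ℂ → ℂ} (hΦ : DifferentiableOn ℂ Φ ({s : ℂ | σ₁ < s.re} ∪ W₀))
    (hagree : EqOn Φ (mellinIoi g) {s : ℂ | σ₁ < s.re}) {σ : ℝ} (hσ : a < σ) :
    IntegrableOn (fun x ↦ g x * x ^ (-(σ + 1))) (Ioi 1) := by
  -- the set of abscissae of absolute convergence in `[a, ∞)` and its infimum
  set T : Set ℝ := {σ' : ℝ | a ≤ σ' ∧ IntegrableOn (fun x ↦ g x * x ^ (-(σ' + 1))) (Ioi 1)}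
    with hT
  have hT₁ : σ₁ ∈ T := ⟨ha.le, hint⟩
  have hTne : T.Nonempty := ⟨σ₁, hT₁⟩
  have hTbdd : BddBelow T := ⟨a, fun σ' hσ' ↦ hσ'.1⟩
  set σc : ℝ := sInf T with hσc
  have hσc₁ : σc ≤ σ₁ := csInf_le hTbdd hT₁
  have haσc : a ≤ σc := le_csInf hTne fun σ' hσ' ↦ hσ'.1
  -- everything to the right of `σc` converges
  have hS : ∀ σ' : ℝ, σc < σ' → IntegrableOn (fun x ↦ g x * x ^ (-(σ' + 1))) (Ioi 1) := by
    intro σ' hσ'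
    obtain ⟨σ'', hσ''T, hlt⟩ := exists_lt_of_csInf_lt hTne hσ'
    exact integrableOn_rpow_of_le hg hlt.le hσ''T.2
  -- it suffices to show `σc = a`
  suffices hca : σc ≤ a by
    exact hS σ (lt_of_le_of_lt hca hσ)
  by_contra hca
  push Not at hca
  -- a disc about `σc` inside `W₀`, of radius `< σc - a`
  have hσcW : ((σc : ℝ) : ℂ) ∈ W₀ := hW₀r σc hca (by linarith)
  obtain ⟨ε, hε, hball⟩ := Metric.isOpen_iff.1 hW₀o _ hσcW
  set r : ℝ := min (ε / 3) ((σc - a) / 2) with hr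
  have hr0 : 0 < r := lt_min (by positivity) (by linarith)
  have hr3 : 3 * r ≤ ε := by
    have : r ≤ ε / 3 := min_le_left _ _
    linarith
  have hra : r < σc - a := by
    have : r ≤ (σc - a) / 2 := min_le_right _ _
    linarith
  -- `F` is holomorphic on `Re s > σc` and agrees with `Φ` on the preconnected open set `V`
  have hF : DifferentiableOn ℂ (mellinIoi g) {s : ℂ | σc < s.re} :=
    differentiableOn_mellinIoi_of_forall hg hS
  set V : Set ℂ := {s : ℂ | σ₁ < s.re} ∪ (W₀ ∩ {s : ℂ | σc < s.re}) with hV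
  have hVo : IsOpen V := (isOpen_re_gt σ₁).union (hW₀o.inter (isOpen_re_gt σc))
  have hVpre : IsPreconnected V := by
    set p : ℂ := ((σ₁ + 1 / 2 : ℝ) : ℂ) with hp
    have hp1 : p ∈ {s : ℂ | σ₁ < s.re} := by simp [hp]
    have hp2 : p ∈ W₀ ∩ {s : ℂ | σc < s.re} := by
      refine ⟨hW₀r _ (by linarith) (by linarith), ?_⟩
      simp only [hp, Set.mem_setOf_eq, ofReal_re]
      linarith
    exact IsPreconnected.union p hp1 hp2 (convex_halfSpace_re_gt σ₁).isPreconnected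
      (hW₀c.inter (convex_halfSpace_re_gt σc)).isPreconnected
  have hΦV : AnalyticOnNhd ℂ Φ V := by
    refine (hΦ.mono ?_).analyticOnNhd hVo
    rintro s (hs | hs)
    · exact Or.inl hs
    · exact Or.inr hs.1
  have hFV : AnalyticOnNhd ℂ (mellinIoi g) V := by
    refine (hF.mono ?_).analyticOnNhd hVo
    rintro s (hs | hs)
    · simp only [Set.mem_setOf_eq] at hs ⊢
      linarith
    · exact hs.2
  have hq : (((σ₁ + 1 : ℝ) : ℂ)) ∈ V := Or.inl (by simp)
  have hev : Φ =ᶠ[𝓝 (((σ₁ + 1 : ℝ) : ℂ))] mellinIoi g := by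
    filter_upwards [(isOpen_re_gt σ₁).mem_nhds (show ((σ₁ + 1 : ℝ) : ℂ) ∈ {s : ℂ | σ₁ < s.re}
      by simp)] with s hs
    exact hagree hs
  have hEq : EqOn Φ (mellinIoi g) V :=
    hΦV.eqOn_of_preconnected_of_eventuallyEq hFV hVpre hq hev
  -- apply the disc form at `σ₂ = σc + r` with radius `2r`
  have hballW : Metric.ball ((σc + r : ℝ) : ℂ) (2 * r) ⊆ W₀ := by
    refine (Metric.ball_subset_ball' ?_).trans hball
    rw [dist_eq_norm, ← ofReal_sub, Complex.norm_real, Real.norm_eq_abs,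
      show σc + r - σc = r by ring, abs_of_pos hr0]
    linarith
  have hΦball : DifferentiableOn ℂ Φ (Metric.ball ((σc + r : ℝ) : ℂ) (2 * r)) :=
    hΦ.mono (hballW.trans Set.subset_union_right)
  have hσ₂V : ((σc + r : ℝ) : ℂ) ∈ V := by
    refine Or.inr ⟨hballW (Metric.mem_ball_self (by linarith)), ?_⟩
    simp only [Set.mem_setOf_eq, ofReal_re]
    linarith
  have hagree₂ : Φ =ᶠ[𝓝 ((σc + r : ℝ) : ℂ)] mellinIoi g := by
    filter_upwards [hVo.mem_nhds hσ₂V] with s hs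
    exact hEq hs
  have hint₂ : IntegrableOn (fun x ↦ g x * x ^ (-((σc + r / 2) + 1))) (Ioi 1) :=
    hS _ (by linarith)
  have hstep := integrableOn_of_differentiableOn_ball hg hint₂ hX₁ hpos
    (show σc + r / 2 < σc + r by linarith) hΦball hagree₂
    (σ := σc - r / 2) (by linarith)
  -- so `σc - r/2 ∈ T`, contradicting `σc = inf T`
  have hmem : σc - r / 2 ∈ T := ⟨by linarith, hstep⟩
  have := csInf_le hTbdd hmem
  linarith

end Landau

end Literature.NumberTheory.LFunctions

end
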